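import Literature.MathematicalPhysics.QuantumFieldTheory.Balaban1983to89.B2StepK
import Literature.MathematicalPhysics.QuantumFieldTheory.Balaban1983to89.B2LargeField
import Literature.MathematicalPhysics.QuantumFieldTheory.Balaban1983to89.HiggsCovariancePos
import Literature.MathematicalPhysics.QuantumFieldTheory.Balaban1983to89.B3MultiscaleFields

/-!
# `Balaban1983to89.B2Eq255Concrete` — T. Bałaban, *(Higgs)₂,₃ quantum fields in a finite volume. II. An upper bound*,
Commun. Math. Phys. **86** (1982) 555–594 [Balaban1982Higgs2], Sect. 2.C p. 570: **the restrictions (2.55) on the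
fields `A, φ` of the `(k+1)`-st step AS A PREDICATE ON THE CONCRETE FIELDS** of the carriers `…HiggsLattice` /
`…HiggsAveraging` / `…HiggsCovariance` (unit-lattice vector field `A`, scalar field `φ`, the `η`-lattice background
`A^{(k)}` through its bond averages `Ā^{(k)}`), and the background scalar field `φ^{(k)}` of (2.56), with bodies

statement-level skeleton of published theorems with citation tags; proofs where landed; nothing here is a claim about the Yang–Mills mass gap

PDF held: `paper:balaban1982-cmp86-higgs23-ii` (journal page = PDF page + 554); pp. 569–570 [PDF 15–16] read on the ×2
renders `run/shared/lean/pub/pub-balaban/b2b-balaban-ref1/pages/1982-cmp86-higgs23-II/1982-cmp86-higgs23-II-p015-x2.png`,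
`…-p016-x2.png`, never from the OCR layer.

CITATION HEADER (lean-in-tree rule).  lit-balaban typed skeleton (HOME `run/shared/lean/pub/lit-balaban/`), typer
line; SKELETON row **B2.Eq2.55** (owners r02 `ROWS-B2.md` / r14; cell before this file: «typed-existing (hypothesis
field `B2.L24Setting.restr255` …) · absent (as predicates on concrete fields) · r14 addendum: typed p239461» — the
pointwise form being r14's `B2StepK.Restr255At c₁ pℓ tA tPhi dA absA dPhi absPhi` on four real numbers; suggestion of
r14 g4, `lit-balaban-typer/INBOX.md` 2026-08-21T05:06:56Z).  THE SOURCE TEXT, p. 569–570, verbatim: *"At first we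
rescale it from the L^kε-lattice T^{(k)}_{L^kε} to 1-lattice T^{(k)}_1. … (2.53) Let us recall the formula for A^{(k)} after
the rescaling A^{(k)} = a_kζ^{(k)}G_kQ_k^*A, (2.54) and the restrictions on the fields A, φ given by the characteristic
functions χ_k: |(∂A)(b)| ≦ c₁p(L^{k−1}ε), |A(x)| ≦ (c₁/(μ₀L^{k−1}ε)) p(L^{k−1}ε), |(D_{Ā^{(k)}}φ)(b)| ≦ c₁p(L^{k−1}ε),
|φ(x)| ≦ (c₁/λ(L^{k−1}ε)^{1/4}) p(L^{k−1}ε) for x ∈ Λ^{(k−1)′}_{−1}, b ⊂ Λ^{(k−1)′}_{−1}, Ā^{(k)}_b = L^{−k} Σ_{⟨x,x′⟩⊂b}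
A^{(k)}_{⟨x,x′⟩}. (2.55) … where of course φ^{(k)} = a_kG_k(B^k(Λ₂^{(k−1)′}), A^{(k)})Q_k^*(A^{(k)})Λ₆^{(k−1)′}φ. (2.56)"*.

HOW IT IS TYPED (reuse, nothing re-declared).  The carrier family `P` is the unit-lattice family of (2.53) (finest
lattice `T_η`, `η = L^{−k}`, level `k` = `T^{(k)}_1`; not forced — every formula carries `P.mesh`); `A : VecField P k`,
`φ : ScalarField P k N` are the fields of (2.53) on `T^{(k)}`, `Ak : VecField P 0` is `A^{(k)}` of (2.54) on `T_η` (any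
field — (2.54) itself is row B2.Eq2.44, r14 `B2StepK.bg244`), the region `Λ = Λ^{(k−1)′}_{−1} ⊂ T^{(k)}` is a `Finset`,
*"b ⊂ Λ"* = both endpoints in `Λ` (`HiggsCovariancePos.Inside`, the convention of p17's `B2Restr216Concrete`).  The four
printed quantities: `|(∂A)(b)|` = the norm of the difference derivative (I.1.4) of the `ℝ^d`-valued site function
`x ↦ (A_μ(x))_μ` (`HiggsLattice.sderiv`, `B3MultiscaleFields.toSite`; p17's reading of the same symbol in (2.2)/(2.16)),
`|A(x)|` = `‖toSite A x‖`, `|(D_{Ā^{(k)}}φ)(b)|` = `‖HiggsLattice.covDeriv C Ā^{(k)} φ b‖` with **`Ā^{(k)}` concrete**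
(`barA`: `L^{−k}` times the sum of `A^{(k)}` over the `L^k` bonds `⟨x, x′⟩` of `T_η` lying on the unit bond `b` — the
straight segment from the `T_η`-image of `b₋` in the direction of `b`, `HiggsAveraging.segSum`/`toFinest`; this is r14's
schematic `B2StepK.bondAvg w fine` at `w = L^{−k}` and these fine-bond sets), `|φ(x)|` = `‖φ x‖`; thresholds as printed
with `ℓ = L^{k−1}ε`, `p(·) = B2.pFn b₀ p`, `λ(·) = B2LargeField.lambdaEps λ · d` ((2.5)), `μ₀`: `Restr255Printed`;
the general-threshold form `Restr255 c₁ pℓ tA tPhi` matches r14's dictionary (`tA ↤ 1/(μ₀L^{k−1}ε)`,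
`tPhi ↤ 1/λ(L^{k−1}ε)^{1/4}`) and unfolds pointwise to `B2StepK.Restr255At` (`restr255At_of_restr255`, and back under
non-emptiness `restr255_of_forall_restr255At`); the characteristic function `χ_k` of the sentence is `chi255`
(values in `{0,1}`).  (2.56): `bgScalar256` = `B1LowerBound.bgField a_k (L^kη) (G_k(B^k(Λ₂′), A^{(k)})) (Q_k^*(A^{(k)}))`
applied to `Λ₆′φ` (`HiggsCovariance.propagatorK` on the region `B^k(Λ₂^{(k−1)′})`, `avgQkAdj`, the cut `cutTo`), i.e.
r14/typer's (I.3.29) shape `B1Eq31Concrete.bgScalar` localized as printed.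
PROVED (kernel, bookkeeping): unfoldings, `barA` of the zero field / additivity / homogeneity, `barA` at `k = 0` is the
field itself, `Restr255` monotone in `c₁` and in the region, the two bridges, `chi255 ∈ {0,1}` and `chi255 = 1 ↔ (2.55)`,
linearity of (2.56) in `φ`, the whole-lattice case of (2.56).
DELIBERATELY NOT HERE: (2.53) (row B2.Eq2.55's integral display; its factors are rows B2.Eq2.44/2.49/2.57), Prop. 2.1.
Unit `lit-balaban-typer` gen 4 (literature-prover-lit-balaban-typer-g4-0); HOME/FILED.md records the proposal.
-/

open scoped BigOperators

namespace Literature.MathematicalPhysics.QuantumFieldTheory.Balaban1983to89.B2Eq255Concrete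

open Literature.MathematicalPhysics.QuantumFieldTheory.Balaban1983to89.HiggsLattice
open Literature.MathematicalPhysics.QuantumFieldTheory.Balaban1983to89.HiggsAveraging
open Literature.MathematicalPhysics.QuantumFieldTheory.Balaban1983to89.HiggsCovariance
open Literature.MathematicalPhysics.QuantumFieldTheory.Balaban1983to89.HiggsCovariancePos (Inside)
open Literature.MathematicalPhysics.QuantumFieldTheory.Balaban1983to89.B3MultiscaleFields (toSite toSite_add)

variable {P : Params} {N : ℕ}

/-! ## 1. `Ā^{(k)}_b = L^{−k} Σ_{⟨x,x′⟩⊂b} A^{(k)}_{⟨x,x′⟩}` -/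

section BarA

/-- **`Ā^{(k)}`** of (2.55) p. 570, verbatim: *"Ā^{(k)}_b = L^{−k} Σ_{⟨x,x′⟩⊂b} A^{(k)}_{⟨x,x′⟩}"* — the average of the
`η`-lattice field `A^{(k)}` over the `L^k` bonds `⟨x, x′⟩` of `T_η` lying on the unit-lattice bond `b = ⟨b₋, b₋ + e_μ⟩`:
the straight segment of `L^k` steps from the `T_η`-image of `b₋` (`HiggsAveraging.toFinest`) in direction `μ`, summed by
`HiggsAveraging.segSum` ((I.2.3)); a bond function on `T^{(k)}`. [cite: Balaban1982Higgs2, (2.55) p.570] -/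
noncomputable def barA (k : ℕ) (Ak : VecField P 0) : VecField P k :=
  fun b => (((P.L : ℝ) ^ k)⁻¹) * segSum Ak (toFinest b.src) b.dir (P.L ^ k)

/-- Unfolding of `barA`: `Ā^{(k)}_{⟨y, y+e_μ⟩} = L^{−k} Σ_{i<L^k} A^{(k)}_{⟨ỹ + iηe_μ, ỹ + (i+1)ηe_μ⟩}`, `ỹ` the `T_η`-image
of `y`. [cite: Balaban1982Higgs2, (2.55) p.570] -/
theorem barA_apply (k : ℕ) (Ak : VecField P 0) (b : PBond P k) :
    barA k Ak b = (((P.L : ℝ) ^ k)⁻¹) * ∑ i ∈ Finset.range (P.L ^ k), Ak ⟨shiftN (toFinest b.src) b.dir i, b.dir⟩ := rfl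

/-- `Ā^{(k)}` of the zero background is zero. [cite: Balaban1982Higgs2, (2.55) p.570] -/
@[simp] theorem barA_zero (k : ℕ) : barA k (0 : VecField P 0) = 0 := by
  funext b
  simp [barA, segSum]

/-- `Ā^{(k)}` is additive in the background field. [cite: Balaban1982Higgs2, (2.55) p.570] -/
theorem barA_add (k : ℕ) (A B : VecField P 0) : barA k (A + B) = barA k A + barA k B := by
  funext b
  simp only [barA, segSum_add, Pi.add_apply]
  ring

/-- `Ā^{(k)}` is homogeneous in the background field. [cite: Balaban1982Higgs2, (2.55) p.570] -/
theorem barA_smul (k : ℕ) (c : ℝ) (A : VecField P 0) : barA k (c • A) = c • barA k A := by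
  funext b
  simp only [barA, segSum, Pi.smul_apply, smul_eq_mul, Finset.mul_sum]
  exact Finset.sum_congr rfl fun i _ => by ring

/-- With no step done (`k = 0`, `T_η = T^{(0)}`) the average over the single bond `⟨x, x′⟩ = b` is the field itself.
[cite: Balaban1982Higgs2, (2.55) p.570] -/
theorem barA_zero_level (Ak : VecField P 0) : barA 0 Ak = Ak := by
  funext b
  have h0 : toFinest (P := P) (k := 0) b.src = b.src := by
    funext μ
    simp [toFinest]
  simp [barA, segSum, shiftN, h0]

end BarA

/-! ## 2. The four printed quantities and the restrictions (2.55) -/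

section Restrictions

variable {k : ℕ}

/-- `|(∂A)(b)|`: the norm of the difference derivative (I.1.4) of the `ℝ^d`-valued site function `x ↦ (A_μ(x))_μ` across
the bond `b` (`(L^kη)^{−1}|A(b₊) − A(b₋)|`; p17's reading of the symbol in (2.2)/(2.16), `B2Restr216Concrete`).
[cite: Balaban1982Higgs2, (2.55) p.570] -/
noncomputable def dA (A : VecField P k) (b : PBond P k) : ℝ := ‖sderiv (toSite A) b‖

/-- `|A(x)|`: the Euclidean norm of `(A_μ(x))_μ`. [cite: Balaban1982Higgs2, (2.55) p.570] -/
noncomputable def absA (A : VecField P k) (x : Site P k) : ℝ := ‖toSite A x‖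

/-- `|(D_{Ā^{(k)}}φ)(b)|`: the covariant derivative (I.1.7) of `φ` on `T^{(k)}` in the bond field `Ā^{(k)}` (`barA`).
[cite: Balaban1982Higgs2, (2.55) p.570] -/
noncomputable def dPhi (C : ChargeData N) (k : ℕ) (Ak : VecField P 0) (φ : ScalarField P k N) (b : PBond P k) : ℝ :=
  ‖covDeriv C (barA k Ak) φ b‖

/-- `|φ(x)|`. [cite: Balaban1982Higgs2, (2.55) p.570] -/
noncomputable def absPhi (φ : ScalarField P k N) (x : Site P k) : ℝ := ‖φ x‖

/-- Unfolding of `dA`. [cite: Balaban1982Higgs2, (2.55) p.570] -/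
theorem dA_eq (A : VecField P k) (b : PBond P k) : dA A b = ‖sderiv (toSite A) b‖ := rfl

/-- Unfolding of `dPhi`. [cite: Balaban1982Higgs2, (2.55) p.570] -/
theorem dPhi_eq (C : ChargeData N) (k : ℕ) (Ak : VecField P 0) (φ : ScalarField P k N) (b : PBond P k) :
    dPhi C k Ak φ b = ‖covDeriv C (barA k Ak) φ b‖ := rfl

/-- With the zero background the covariant derivative is the plain difference derivative: `|(D_0φ)(b)| = |(∂φ)(b)|`.
[cite: Balaban1982Higgs2, (2.55) p.570] -/
theorem dPhi_zero (C : ChargeData N) (k : ℕ) (φ : ScalarField P k N) (b : PBond P k) :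
    dPhi C k (0 : VecField P 0) φ b = ‖sderiv φ b‖ := by
  rw [dPhi_eq, barA_zero, covDeriv_zero]

/-- **(2.55)** p. 570 [PDF 16] ON THE CONCRETE FIELDS, general thresholds (r14's dictionary for
`B2StepK.Restr255At`: `pℓ` ↤ p(L^{k−1}ε), `tA` ↤ 1/(μ₀L^{k−1}ε), `tPhi` ↤ 1/λ(L^{k−1}ε)^{1/4}): for all bonds `b` with both
endpoints in `Λ` and all sites `x ∈ Λ` (`Λ` ↤ Λ^{(k−1)′}_{−1} ⊂ T^{(k)}),
`|(∂A)(b)| ≤ c₁pℓ ∧ |A(x)| ≤ c₁·tA·pℓ ∧ |(D_{Ā^{(k)}}φ)(b)| ≤ c₁pℓ ∧ |φ(x)| ≤ c₁·tPhi·pℓ`. [cite: Balaban1982Higgs2, (2.55) p.570] -/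
def Restr255 (C : ChargeData N) (c₁ pℓ tA tPhi : ℝ) (k : ℕ) (Λ : Finset (Site P k)) (A : VecField P k)
    (φ : ScalarField P k N) (Ak : VecField P 0) : Prop :=
  (∀ b : PBond P k, Inside Λ b → dA A b ≤ c₁ * pℓ) ∧
  (∀ x ∈ Λ, absA A x ≤ c₁ * tA * pℓ) ∧
  (∀ b : PBond P k, Inside Λ b → dPhi C k Ak φ b ≤ c₁ * pℓ) ∧
  (∀ x ∈ Λ, absPhi φ x ≤ c₁ * tPhi * pℓ)

/-- **(2.55) WITH THE PRINTED THRESHOLDS**: `ℓ` ↤ L^{k−1}ε, `p(ℓ) = b₀(1 + log ℓ⁻¹)^p` (`B2.pFn`, (2.2)),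
`λ(ℓ) = λℓ^{4−d}` (`B2LargeField.lambdaEps`, (2.5)), `μ₀` the vector-field mass: *"|(∂A)(b)| ≦ c₁p(L^{k−1}ε), |A(x)| ≦
(c₁/(μ₀L^{k−1}ε))p(L^{k−1}ε), |(D_{Ā^{(k)}}φ)(b)| ≦ c₁p(L^{k−1}ε), |φ(x)| ≦ (c₁/λ(L^{k−1}ε)^{1/4})p(L^{k−1}ε)"*.
[cite: Balaban1982Higgs2, (2.55) p.570] -/
def Restr255Printed (C : ChargeData N) (c₁ b₀ p μ₀ lam ℓ : ℝ) (k : ℕ) (Λ : Finset (Site P k)) (A : VecField P k)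
    (φ : ScalarField P k N) (Ak : VecField P 0) : Prop :=
  Restr255 C c₁ (B2.pFn b₀ p ℓ) (1 / (μ₀ * ℓ)) (1 / (B2LargeField.lambdaEps lam ℓ P.d) ^ (1 / 4 : ℝ)) k Λ A φ Ak

/-- Unfolding of `Restr255Printed` to the four printed inequalities. [cite: Balaban1982Higgs2, (2.55) p.570] -/
theorem restr255Printed_iff (C : ChargeData N) (c₁ b₀ p μ₀ lam ℓ : ℝ) (k : ℕ) (Λ : Finset (Site P k))
    (A : VecField P k) (φ : ScalarField P k N) (Ak : VecField P 0) :
    Restr255Printed C c₁ b₀ p μ₀ lam ℓ k Λ A φ Ak ↔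
      (∀ b : PBond P k, Inside Λ b → dA A b ≤ c₁ * B2.pFn b₀ p ℓ) ∧
      (∀ x ∈ Λ, absA A x ≤ c₁ * (1 / (μ₀ * ℓ)) * B2.pFn b₀ p ℓ) ∧
      (∀ b : PBond P k, Inside Λ b → dPhi C k Ak φ b ≤ c₁ * B2.pFn b₀ p ℓ) ∧
      (∀ x ∈ Λ, absPhi φ x ≤ c₁ * (1 / (B2LargeField.lambdaEps lam ℓ P.d) ^ (1 / 4 : ℝ)) * B2.pFn b₀ p ℓ) :=
  Iff.rfl

/-- **Bridge to r14's pointwise form**: under (2.55) on `Λ`, every inside bond `b` and site `x ∈ Λ` satisfy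
`B2StepK.Restr255At c₁ pℓ tA tPhi |(∂A)(b)| |A(x)| |(D_{Ā^{(k)}}φ)(b)| |φ(x)|`. [cite: Balaban1982Higgs2, (2.55) p.570] -/
theorem restr255At_of_restr255 {C : ChargeData N} {c₁ pℓ tA tPhi : ℝ} {k : ℕ} {Λ : Finset (Site P k)}
    {A : VecField P k} {φ : ScalarField P k N} {Ak : VecField P 0} (h : Restr255 C c₁ pℓ tA tPhi k Λ A φ Ak)
    {b : PBond P k} (hb : Inside Λ b) {x : Site P k} (hx : x ∈ Λ) :
    B2StepK.Restr255At c₁ pℓ tA tPhi (dA A b) (absA A x) (dPhi C k Ak φ b) (absPhi φ x) :=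
  ⟨h.1 b hb, h.2.1 x hx, h.2.2.1 b hb, h.2.2.2 x hx⟩

/-- Conversely, the pointwise form at every (inside bond, site) pair gives (2.55) on `Λ`, provided `Λ` has an inside
bond (so that both index sets are nonempty). [cite: Balaban1982Higgs2, (2.55) p.570] -/
theorem restr255_of_forall_restr255At {C : ChargeData N} {c₁ pℓ tA tPhi : ℝ} {k : ℕ} {Λ : Finset (Site P k)}
    {A : VecField P k} {φ : ScalarField P k N} {Ak : VecField P 0} (hne : ∃ b : PBond P k, Inside Λ b)
    (h : ∀ (b : PBond P k) (x : Site P k), Inside Λ b → x ∈ Λ →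
      B2StepK.Restr255At c₁ pℓ tA tPhi (dA A b) (absA A x) (dPhi C k Ak φ b) (absPhi φ x)) :
    Restr255 C c₁ pℓ tA tPhi k Λ A φ Ak := by
  obtain ⟨b₀, hb₀⟩ := hne
  refine ⟨fun b hb => (h b b₀.src hb hb₀.1).1, fun x hx => (h b₀ x hb₀ hx).2.1,
    fun b hb => (h b b₀.src hb hb₀.1).2.2.1, fun x hx => (h b₀ x hb₀ hx).2.2.2⟩

/-- (2.55) is monotone in `c₁` for non-negative thresholds (the paper's *"a suitably larger constant"*;
`B2StepK.Restr255At.mono` fieldwise). [cite: Balaban1982Higgs2, (2.55) p.570] -/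
theorem Restr255.mono {C : ChargeData N} {c₁ c₂ pℓ tA tPhi : ℝ} {k : ℕ} {Λ : Finset (Site P k)} {A : VecField P k}
    {φ : ScalarField P k N} {Ak : VecField P 0} (hc : c₁ ≤ c₂) (hp : 0 ≤ pℓ) (htA : 0 ≤ tA) (htPhi : 0 ≤ tPhi)
    (h : Restr255 C c₁ pℓ tA tPhi k Λ A φ Ak) : Restr255 C c₂ pℓ tA tPhi k Λ A φ Ak := by
  refine ⟨fun b hb => (h.1 b hb).trans (mul_le_mul_of_nonneg_right hc hp),
    fun x hx => (h.2.1 x hx).trans ?_, fun b hb => (h.2.2.1 b hb).trans (mul_le_mul_of_nonneg_right hc hp),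
    fun x hx => (h.2.2.2 x hx).trans ?_⟩
  · exact mul_le_mul_of_nonneg_right (mul_le_mul_of_nonneg_right hc htA) hp
  · exact mul_le_mul_of_nonneg_right (mul_le_mul_of_nonneg_right hc htPhi) hp

/-- (2.55) restricts to sub-regions. [cite: Balaban1982Higgs2, (2.55) p.570] -/
theorem Restr255.anti {C : ChargeData N} {c₁ pℓ tA tPhi : ℝ} {k : ℕ} {Λ Λ' : Finset (Site P k)} {A : VecField P k}
    {φ : ScalarField P k N} {Ak : VecField P 0} (hsub : Λ' ⊆ Λ) (h : Restr255 C c₁ pℓ tA tPhi k Λ A φ Ak) :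
    Restr255 C c₁ pℓ tA tPhi k Λ' A φ Ak :=
  ⟨fun b hb => h.1 b ⟨hsub hb.1, hsub hb.2⟩, fun x hx => h.2.1 x (hsub hx),
    fun b hb => h.2.2.1 b ⟨hsub hb.1, hsub hb.2⟩, fun x hx => h.2.2.2 x (hsub hx)⟩

/-- The characteristic function `χ_k` of the sentence *"the restrictions on the fields A, φ given by the characteristic
functions χ_k"* p. 570: `1` if (2.55) holds on `Λ`, `0` otherwise. [cite: Balaban1982Higgs2, (2.55) p.570] -/
noncomputable def chi255 (C : ChargeData N) (c₁ pℓ tA tPhi : ℝ) (k : ℕ) (Λ : Finset (Site P k)) (A : VecField P k)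
    (φ : ScalarField P k N) (Ak : VecField P 0) : ℝ :=
  by classical exact if Restr255 C c₁ pℓ tA tPhi k Λ A φ Ak then 1 else 0

/-- `χ_k = 1 ↔ (2.55)`. [cite: Balaban1982Higgs2, (2.55) p.570] -/
theorem chi255_eq_one_iff (C : ChargeData N) (c₁ pℓ tA tPhi : ℝ) (k : ℕ) (Λ : Finset (Site P k)) (A : VecField P k)
    (φ : ScalarField P k N) (Ak : VecField P 0) :
    chi255 C c₁ pℓ tA tPhi k Λ A φ Ak = 1 ↔ Restr255 C c₁ pℓ tA tPhi k Λ A φ Ak := by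
  unfold chi255
  split_ifs with h
  · simp [h]
  · simp [h]

/-- `χ_k ∈ {0, 1}`. [cite: Balaban1982Higgs2, (2.55) p.570] -/
theorem chi255_mem (C : ChargeData N) (c₁ pℓ tA tPhi : ℝ) (k : ℕ) (Λ : Finset (Site P k)) (A : VecField P k)
    (φ : ScalarField P k N) (Ak : VecField P 0) :
    chi255 C c₁ pℓ tA tPhi k Λ A φ Ak = 0 ∨ chi255 C c₁ pℓ tA tPhi k Λ A φ Ak = 1 := by
  unfold chi255
  split_ifs <;> simp

/-- `0 ≤ χ_k ≤ 1`. [cite: Balaban1982Higgs2, (2.55) p.570] -/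
theorem chi255_mem_Icc (C : ChargeData N) (c₁ pℓ tA tPhi : ℝ) (k : ℕ) (Λ : Finset (Site P k)) (A : VecField P k)
    (φ : ScalarField P k N) (Ak : VecField P 0) :
    chi255 C c₁ pℓ tA tPhi k Λ A φ Ak ∈ Set.Icc (0 : ℝ) 1 := by
  rcases chi255_mem C c₁ pℓ tA tPhi k Λ A φ Ak with h | h <;> rw [h] <;> norm_num

end Restrictions

/-! ## 3. (2.56): the background scalar field `φ^{(k)}` -/

section Background

variable {k : ℕ}

/-- The cut `Λφ` of a scalar field to a region (p. 556/608: *"we will write Λf and it means the product of the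
characteristic function Λ and the function f"*). [cite: Balaban1982Higgs2, (2.56) p.570] -/
noncomputable def cutTo (Λ : Finset (Site P k)) (φ : ScalarField P k N) : ScalarField P k N :=
  fun x => if x ∈ Λ then φ x else 0

/-- On `Λ` the cut field is the field. [cite: Balaban1982Higgs2, (2.56) p.570] -/
theorem cutTo_of_mem (Λ : Finset (Site P k)) (φ : ScalarField P k N) {x : Site P k} (hx : x ∈ Λ) :
    cutTo Λ φ x = φ x := by
  simp [cutTo, hx]

/-- Off `Λ` the cut field vanishes. [cite: Balaban1982Higgs2, (2.56) p.570] -/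
theorem cutTo_of_not_mem (Λ : Finset (Site P k)) (φ : ScalarField P k N) {x : Site P k} (hx : x ∉ Λ) :
    cutTo Λ φ x = 0 := by
  simp [cutTo, hx]

/-- The cut to the whole lattice is the identity. [cite: Balaban1982Higgs2, (2.56) p.570] -/
theorem cutTo_univ (φ : ScalarField P k N) : cutTo Finset.univ φ = φ := by
  funext x
  simp [cutTo]

/-- The cut as a linear map. [cite: Balaban1982Higgs2, (2.56) p.570] -/
noncomputable def cutToLin (Λ : Finset (Site P k)) : ScalarField P k N →ₗ[ℝ] ScalarField P k N where
  toFun := cutTo Λ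
  map_add' φ ψ := by
    funext x
    by_cases hx : x ∈ Λ <;> simp [cutTo, hx]
  map_smul' c φ := by
    funext x
    by_cases hx : x ∈ Λ <;> simp [cutTo, hx]

/-- `cutToLin` is `cutTo`. [cite: Balaban1982Higgs2, (2.56) p.570] -/
theorem cutToLin_apply (Λ : Finset (Site P k)) (φ : ScalarField P k N) : cutToLin Λ φ = cutTo Λ φ := rfl

/-- `B^k(Λ₂) ⊂ T_η`: the `η`-lattice region under a region of the unit lattice `T^{(k)}` (`x ∈ B^k(Λ₂) ↔ x_k ∈ Λ₂`,
`HiggsAveraging.blockIter`). [cite: Balaban1982Higgs2, (2.56) p.570] -/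
def underRegion (k : ℕ) (Λ₂ : Finset (Site P k)) : Finset (Site P 0) :=
  Finset.univ.filter fun x => blockIter k x ∈ Λ₂

/-- `x ∈ B^k(Λ₂) ↔ x_k ∈ Λ₂`. [cite: Balaban1982Higgs2, (2.56) p.570] -/
theorem mem_underRegion (k : ℕ) (Λ₂ : Finset (Site P k)) (x : Site P 0) :
    x ∈ underRegion k Λ₂ ↔ blockIter k x ∈ Λ₂ := by
  simp [underRegion]

/-- **(2.56)** p. 570 [PDF 16], verbatim: *"where of course φ^{(k)} = a_kG_k(B^k(Λ₂^{(k−1)′}), A^{(k)})Q_k^*(A^{(k)})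
Λ₆^{(k−1)′}φ. (2.56)"* — the background scalar field on `T_η`: r12's (I.3.29) shape `B1LowerBound.bgField a_k (L^kη) G Q^*`
at the CONCRETE propagator `G_k(B^k(Λ₂′), A^{(k)})` = `HiggsCovariance.propagatorK` with Neumann conditions on the
region `B^k(Λ₂′)` ((I.2.22); `msq` ↤ `m²(L^kε)²`, `a_k(L^kη)^{−2} = a_k` on the unit lattice) and `Q_k^*(A^{(k)})` =
`HiggsCovariance.avgQkAdj`, applied to the cut field `Λ₆′φ`.  The whole-lattice, uncut case is typer's
`B1Eq31Concrete.bgScalar` ((I.3.29)). [cite: Balaban1982Higgs2, (2.56) p.570] -/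
noncomputable def bgScalar256 (C : ChargeData N) (msq a : ℝ) (k : ℕ) (Λ₂ Λ₆ : Finset (Site P k)) (Ak : VecField P 0)
    (φ : ScalarField P k N) : ScalarField P 0 N :=
  B1LowerBound.bgField (B1.aSeq a P.L k) (P.mesh k) (propagatorK C (underRegion k Λ₂) Ak msq a k)
    (avgQkAdj C Ak k) (cutTo Λ₆ φ)

/-- Unfolding of (2.56): `φ^{(k)} = a_k(L^kη)^{−2}·G_k(B^k(Λ₂′), A^{(k)})(Q_k^*(A^{(k)})(Λ₆′φ))`. [cite: Balaban1982Higgs2, (2.56) p.570] -/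
theorem bgScalar256_eq (C : ChargeData N) (msq a : ℝ) (k : ℕ) (Λ₂ Λ₆ : Finset (Site P k)) (Ak : VecField P 0)
    (φ : ScalarField P k N) :
    bgScalar256 C msq a k Λ₂ Λ₆ Ak φ
      = (B1.aSeq a P.L k * (P.mesh k ^ 2)⁻¹) •
          propagatorK C (underRegion k Λ₂) Ak msq a k (avgQkAdj C Ak k (cutTo Λ₆ φ)) := rfl

/-- (2.56) is linear in `φ`. [cite: Balaban1982Higgs2, (2.56) p.570] -/
theorem bgScalar256_add (C : ChargeData N) (msq a : ℝ) (k : ℕ) (Λ₂ Λ₆ : Finset (Site P k)) (Ak : VecField P 0)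
    (φ ψ : ScalarField P k N) :
    bgScalar256 C msq a k Λ₂ Λ₆ Ak (φ + ψ) = bgScalar256 C msq a k Λ₂ Λ₆ Ak φ + bgScalar256 C msq a k Λ₂ Λ₆ Ak ψ := by
  unfold bgScalar256
  rw [← cutToLin_apply, map_add, B1LowerBound.bgField_add, cutToLin_apply, cutToLin_apply]

/-- With both regions the whole lattice (no localization, no cut) (2.56) is the (I.3.29) background field of the
typer's `B1Eq31Concrete.bgScalar` shape, written out. [cite: Balaban1982Higgs2, (2.56) p.570] -/
theorem bgScalar256_univ (C : ChargeData N) (msq a : ℝ) (k : ℕ) (Ak : VecField P 0) (φ : ScalarField P k N) :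
    bgScalar256 C msq a k Finset.univ Finset.univ Ak φ
      = B1LowerBound.bgField (B1.aSeq a P.L k) (P.mesh k) (propagatorK C Finset.univ Ak msq a k)
          (avgQkAdj C Ak k) φ := by
  have h : underRegion (P := P) k Finset.univ = Finset.univ := by
    ext x
    simp [underRegion]
  rw [bgScalar256, h, cutTo_univ]

end Background

end Literature.MathematicalPhysics.QuantumFieldTheory.Balaban1983to89.B2Eq255Concrete
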